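import Literature.NumberTheory.GaloisRepresentations.SemiLocalShapiro
import Literature.NumberTheory.GaloisRepresentations.LocalUnitsFundamentalClass
import Literature.NumberTheory.Automorphic.AdicCompletionLocalField
import HarnessLib

/-!
# The completion layers `E_w/F_v` of a Galois extension of number fields are CLASS MODULES;
# `|H²(Gal(E/F), ∏_{w ∣ v} E_wˣ)| = [E_w : F_v] = #G_w` (cyclic), `H³(Gal(E/F), ∏_{w ∣ v} E_wˣ) = 0`
# (Tate, C–F VII §7.3 Prop. 7.3 (b) with Cor. 7.4 (b); Harari Prop. 13.1 (b); `H³ = 0`: Harari Cor. 13.2)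

Topic `NumberTheory/GaloisRepresentations`; namespace `Literature.NumberTheory.GaloisRepresentations.SemiLocal`.
Theorems only; NO definition, no named fact, no `sorry`, no instance; number fields in `Type`.

The glue between this seat's semi-local Shapiro (`SemiLocalShapiro`: `Hⁿ(Gal(E/F), ∏_{w∣v} E_wˣ) ≅
Hⁿ(Gal(E_w/F_v), E_wˣ)`, `G_w ≃* Gal(E_w/F_v)`, `IsGalois F_v E_w`, `[E_w : F_v] = #G_w`) and door-c6's
LOCAL class formation in the engine's currency (`LocalUnitsFundamentalClass`: for every finite Galois `L/K`
of a non-archimedean local field `K`, with `K L : Type` ABSTRACT, `∃ φ, IsClassModule (Rep.ofAlgebraAutOnUnits K L) φ`,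
`|H²| = [L:K]` cyclic, `H³ = 0`, Tate's theorem on every sub-layer): the completion `F_v` is a
non-archimedean local field (tree instance `instIsNonarchimedeanLocalFieldAdicCompletion`) and `E_w/F_v` is
finite Galois, so the layer `(Gal(E_w/F_v), E_wˣ)` qualifies, and the Shapiro file transports the
consequences to the `Gal(E/F)`-module `∏_{w∣v} E_wˣ` — one summand of Tate's Prop. 7.3 (b)
"`Ĥ^r(G, J_L) ≃ ∐_v Ĥ^r(G^v, (L^v)^*)`" read with Cor. 7.4 (b) "`H²(G, J_L) ≃ ∐_v (1/n_v)Z/Z`, where `n_v = [L^v : K_v]`"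
(so the `v`-summand is cyclic of order `n_v`), and, for `H³ = 0` (which Tate's 7.3/7.4 do not state), Harari's Cor. 13.2
"`H¹(G, I_K) = H³(G, I_K) = 0`" at one finite place (`H¹`: `SemiLocal.isZero_H1_unitsRep`).

## What is formalised (`F E : Type`, `[IsGalois F E]`, `w : Place F E v`)

* **`exists_isClassModule_place`** — `∃ φ, IsClassModule (Rep.ofAlgebraAutOnUnits F_v E_w) φ`.
* `natCard_H2_autOnUnits_place` (`|H²(Gal(E_w/F_v), E_wˣ)| = #G_w`), **`natCard_H2_unitsRep`** (`|H²(Gal(E/F),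
  ∏_{w∣v} E_wˣ)| = #G_w`), `natCard_H2_unitsRep_eq_finrank` (`= [E_w : F_v]`), **`isAddCyclic_H2_unitsRep`**.
* `isZero_H3_autOnUnits_place`, **`isZero_H3_unitsRep`** (`H³(Gal(E/F), ∏_{w∣v} E_wˣ) = 0`).
* `nonempty_tateIso_place` — Tate's theorem `Ĥⁿ(U, ℤ) ≅ Ĥⁿ⁺²(U, E_wˣ)` for every `U ≤ Gal(E_w/F_v)`.

## References
* J. W. S. Cassels, A. Fröhlich (eds.), *Algebraic Number Theory* (1967), Ch. VII (Tate) §7.3: Prop. 7.3 (b)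
  "`Ĥ^r(G, J_L) ≃ ∐_v Ĥ^r(G^v, (L^v)^*)`", Cor. 7.4 (a) "`H¹(G, J_L) = 0`", (b) "`H²(G, J_L) ≃ ∐_v (1/n_v)Z/Z`"
  (no `H³` statement there). [CasselsFrohlichANT1967]
* D. Harari, *Galois Cohomology and Class Field Theory*, Springer (2020), Prop. 13.1 (b), Cor. 13.2. [Harari2020]
* J.-P. Serre, *Local Fields*, GTM 67 (1979), Ch. XIII §3 Cor. 2 to Prop. 7 ("the isomorphism `inv_K` maps the subgroup `H²(L/K)` of `B_K`
  onto the subgroup `(1/n)Z/Z`"), §4 Thm. 1. [SerreLocalFields1979]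
-/

noncomputable section

open NumberField IsDedekindDomain CategoryTheory CategoryTheory.Limits groupCohomology
open Literature.NumberTheory.Automorphic
open scoped Classical

namespace Literature.NumberTheory.GaloisRepresentations

namespace SemiLocal

open Literature.Algebra.Homology

variable {F : Type} [Field F] [NumberField F] {E : Type} [Field E] [NumberField E] [Algebra F E]
variable {v : HeightOneSpectrum (𝓞 F)}

/-- **The completion layer `E_w/F_v` of a Galois extension of number fields is a class module** (door-c6's
`UnitsLayer.exists_isClassModule_units_of_isGalois` at `K = F_v`, a non-archimedean local field, `L = E_w`,
finite Galois by `finiteDimensional_place` / `isGalois_place`). [cite: SerreLocalFields1979, Ch. XIII §4 Thm. 1] -/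
theorem exists_isClassModule_place [IsGalois F E] (w : Place F E v) :
    ∃ φ : cocycles₂ (Rep.ofAlgebraAutOnUnits (v.adicCompletion F) ((w : HeightOneSpectrum (𝓞 E)).adicCompletion E)),
      IsClassModule (Rep.ofAlgebraAutOnUnits (v.adicCompletion F) ((w : HeightOneSpectrum (𝓞 E)).adicCompletion E)) φ := by
  haveI := finiteDimensional_place (K := F) w
  haveI := isGalois_place (F := F) w
  exact UnitsLayer.exists_isClassModule_units_of_isGalois (v.adicCompletion F) _

/-- **`|H²(Gal(E_w/F_v), E_wˣ)| = #G_w`** (`= [E_w:F_v]`, the local class field axiom at a completion).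
[cite: SerreLocalFields1979, Ch. XIII §3 Cor. 2 to Prop. 7] -/
theorem natCard_H2_autOnUnits_place [IsGalois F E] (w : Place F E v) :
    Nat.card (groupCohomology (Rep.ofAlgebraAutOnUnits (v.adicCompletion F)
      ((w : HeightOneSpectrum (𝓞 E)).adicCompletion E)) 2) = Nat.card (MulAction.stabilizer (E ≃ₐ[F] E) w) := by
  haveI := finiteDimensional_place (K := F) w
  haveI := isGalois_place (F := F) w
  rw [UnitsLayer.natCard_H2_units_eq_card_of_isGalois, natCard_algEquiv_place]

/-- **`|H²(Gal(E/F), ∏_{w∣v} E_wˣ)| = #G_w`** (Tate: `H²(G, ∏_{w∣v} L_wˣ) ≅ H²(G_v, L_vˣ)` cyclic of order `n_v`;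
Shapiro `natCard_groupCohomology_unitsRep` + the local count). [cite: CasselsFrohlichANT1967, Ch. VII §7.3] -/
theorem natCard_H2_unitsRep [IsGalois F E] (w : Place F E v) :
    Nat.card (groupCohomology (unitsRep F E v) 2) = Nat.card (MulAction.stabilizer (E ≃ₐ[F] E) w) := by
  rw [natCard_groupCohomology_unitsRep w 2, natCard_H2_autOnUnits_place]

/-- `|H²(Gal(E/F), ∏_{w∣v} E_wˣ)| = [E_w : F_v]` (the local degree `n_v`). [cite: CasselsFrohlichANT1967, Ch. VII §7.3] -/
theorem natCard_H2_unitsRep_eq_finrank [IsGalois F E] (w : Place F E v) :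
    Nat.card (groupCohomology (unitsRep F E v) 2) =
      Module.finrank (v.adicCompletion F) ((w : HeightOneSpectrum (𝓞 E)).adicCompletion E) := by
  rw [natCard_H2_unitsRep w, finrank_place_eq_card_stabilizer]

/-- **`H²(Gal(E/F), ∏_{w∣v} E_wˣ)` is cyclic** (transport of `isAddCyclic_H2_units_of_isGalois` along Shapiro).
[cite: CasselsFrohlichANT1967, Ch. VII §7.3] -/
theorem isAddCyclic_H2_unitsRep [IsGalois F E] (w : Place F E v) :
    IsAddCyclic (groupCohomology (unitsRep F E v) 2) := by
  haveI := finiteDimensional_place (K := F) w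
  haveI := isGalois_place (F := F) w
  haveI := UnitsLayer.isAddCyclic_H2_units_of_isGalois (v.adicCompletion F)
    ((w : HeightOneSpectrum (𝓞 E)).adicCompletion E)
  exact isAddCyclic_of_surjective ((groupCohomologyUnitsRepIsoAut w 2).symm.toLinearEquiv.toAddMonoidHom)
    (groupCohomologyUnitsRepIsoAut w 2).symm.toLinearEquiv.surjective

/-- **`H³(Gal(E_w/F_v), E_wˣ) = 0`** (class module: `isZero_H3_res_units_of_isGalois` at `U = ⊤`, transported along
`Subgroup.topEquiv`). [cite: Harari2020, §13.1 Cor. 13.2 (proof)] -/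
theorem isZero_H3_autOnUnits_place [IsGalois F E] (w : Place F E v) :
    IsZero (groupCohomology (Rep.ofAlgebraAutOnUnits (v.adicCompletion F)
      ((w : HeightOneSpectrum (𝓞 E)).adicCompletion E)) 3) := by
  haveI := finiteDimensional_place (K := F) w
  haveI := isGalois_place (F := F) w
  have h := UnitsLayer.isZero_H3_res_units_of_isGalois (v.adicCompletion F)
    ((w : HeightOneSpectrum (𝓞 E)).adicCompletion E) ⊤
  exact h.of_iso (groupCohomology.mapIso (Subgroup.topEquiv : (⊤ : Subgroup ((w : HeightOneSpectrum (𝓞 E)).adicCompletion E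
      ≃ₐ[v.adicCompletion F] (w : HeightOneSpectrum (𝓞 E)).adicCompletion E)) ≃* _).symm
    (LinearEquiv.refl ℤ _) (fun _ => rfl) 3)

/-- **`H³(Gal(E/F), ∏_{w∣v} E_wˣ) = 0`** at every finite place (Harari Cor. 13.2, second half, place by place;
Shapiro `isZero_groupCohomology_unitsRep_of_isZero`). [cite: Harari2020, §13.1 Cor. 13.2][cite: CasselsFrohlichANT1967, Ch. VII §7.3] -/
theorem isZero_H3_unitsRep [IsGalois F E] (v : HeightOneSpectrum (𝓞 F)) :
    IsZero (groupCohomology (unitsRep F E v) 3) := by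
  obtain ⟨w⟩ := (inferInstance : Nonempty (Place F E v))
  exact isZero_groupCohomology_unitsRep_of_isZero w 3 (isZero_H3_autOnUnits_place w)

/-- **Tate's theorem at a completion**: `Ĥⁿ(U, ℤ) ≅ Ĥⁿ⁺²(U, E_wˣ)` for every `U ≤ Gal(E_w/F_v)` and `n ∈ ℤ`
(door-c6's `nonempty_tateIso_units_of_isGalois`). [cite: SerreLocalFields1979, Ch. XIII §4 Thm. 1][cite: Neukirch2013, Part I §7 Thm. (7.3)] -/
theorem nonempty_tateIso_place [IsGalois F E] (w : Place F E v)
    (U : Subgroup ((w : HeightOneSpectrum (𝓞 E)).adicCompletion E ≃ₐ[v.adicCompletion F]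
      (w : HeightOneSpectrum (𝓞 E)).adicCompletion E)) [Fintype U] (n : ℤ) :
    Nonempty (tateCohomology (Rep.res U.subtype (Rep.trivial ℤ _ ℤ)) n ≅
      tateCohomology (Rep.res U.subtype (Rep.ofAlgebraAutOnUnits (v.adicCompletion F)
        ((w : HeightOneSpectrum (𝓞 E)).adicCompletion E))) (n + 2)) := by
  haveI := finiteDimensional_place (K := F) w
  haveI := isGalois_place (F := F) w
  exact UnitsLayer.nonempty_tateIso_units_of_isGalois (v.adicCompletion F) _ U n

end SemiLocal
end Literature.NumberTheory.GaloisRepresentations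

end
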